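import Summits.Schanuel.Schanuel.Theorems.RootDecomp1BMovingZero06

/-!
# RootDecomp1BMovingZero — lens 4, generation 35/36 «AX-TRANSVERSAL MOVING ZERO»: T″ = `IsolatedIntersectionGeneral` PROVED modulo ONE print fact (`CurveSelection`) + the tree Ax statement, and SUB-PIECE A = `AnalyticMovingZero` PROVED modulo TWO print facts (`RoucheMaps`, `IsolatedZeroLowerBound`) — continuation (RootDecomp1BMovingZero07): §E (3/3) `slope_trichotomy`, `logLine_top_coeff_eq_zero` (all slopes), controls

(lens-4 g35 HOME kernels MovingZeroTpp.lean 6bf08f88…de4e (2338 l = §G03 MovingZeroGeneral03 b461aa70… + §E MovingZeroExpPoly fdd5ca6b… + §X MovingZeroAxGerms a74f0949… verbatim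
bodies + NEW §T) and MovingZeroPieceA.lean 8899dedb…8da9 (238 l); ADDENDUM-2 L1857, writer re-check L1858, critic RULING L1859 (T″ VERIFIED and BOOKED; `CurveSelection`
ACCEPTED as THE ONE T-fact), RESULT/DONE L1865, critic RULING/ADDENDUM L1867 (A VERIFIED and BOOKED; `RoucheMaps` / `IsolatedZeroLowerBound` ACCEPTED AS TYPED),
lens-4 g36 NOTE/CLAIM L1871 (PORT-READY) and critic ACK L1875 (PORT STAGING GO; credits T (L1859) and A (L1867) paid at the critic's verification of the
accepted parts carrying `isolatedIntersectionGeneral_of_curveSelection` resp. `analyticMovingZero_of_facts`); port by census-1 gen 17 as `RootDecomp1BMovingZero03`–`10`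
PORT EDITS: the 44 `#guard_msgs in #print axioms` guards and their section headers dropped (HOME probes); `set_option linter.dupNamespace false` dropped; PieceA's
character-identical copy of `AnalyticMovingZero` dropped (§A's definition is used; its Facts + Proof sections follow §A in part 04); the four re-proved
`AxSchanuelTwoGerms` helpers (`exists_algDerivation_eq_derivative'`, `ofPowerSeries_taylor_exp_ne_zero'`, `algebraMap_eq_ofPowerSeries_C'`, `taylor_const'`) PRIVATE in
part 08 (statement-twins of the unbuilt Literature module) with a notation-free private copy `taylor_const''` in part 09; `CurveSelection`'s docstring replaced by the
FACT (T-ii) text dictated in L1871 (ACK L1875); the three fact docstrings' cite KEYS normalised to references.bib (`Chirka1989`, `DAngeloSCV1993` — the gate's cite-key lint), locators unchanged; nine one-line docstrings added; statements and proofs otherwise verbatim; `AxRankBoundLaurent` stays a binder BY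
NAME (discharge: HOME MovingZeroAxGermsTree.lean c3203867… once `AxSchanuelUniv` builds on the farm). `--supports stmt-Schanuel-32406`; no census credit carried;
rung 0 — nothing here proves Schanuel.)
-/

noncomputable section

namespace Summit.Schanuel.Schanuel.Theorems.RootDecomp1BMovingZero

section Epart

open Complex Filter Topology

/-! ### The slope trichotomy of T″'s log-line analysis -/

/-- **Slope trichotomy.** For IRRATIONAL `ρ` and any real slope `lam`, exactly the three sub-cases of T″'s log-line
analysis occur: `1, lam, ρ` are `ℚ`-linearly independent, or `lam = α + βρ` with `α, β ∈ ℚ`, `β ≠ 0`, or `lam ∈ ℚ`.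
(A `ℚ`-dependency `u + v·lam + w·ρ = 0` must have `v ≠ 0` since `ρ ∉ ℚ`; solve for `lam`.)  In particular the
«Möbius» presentation `λ = (a + cρ)/(b + dρ)` of the critic's RULING L1839 needs no separate treatment. -/
theorem slope_trichotomy {ρ : ℝ} (hρ : Irrational ρ) (lam : ℝ) :
    LinearIndependent ℚ ![(1 : ℝ), lam, ρ] ∨ (∃ α β : ℚ, β ≠ 0 ∧ lam = (α : ℝ) + β * ρ) ∨ (∃ r : ℚ, lam = r) := by
  by_cases hli : LinearIndependent ℚ ![(1 : ℝ), lam, ρ]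
  · exact Or.inl hli
  · right
    rw [Fintype.not_linearIndependent_iff] at hli
    obtain ⟨g, hg, i, hi⟩ := hli
    simp only [Fin.sum_univ_three, Matrix.cons_val_zero, Matrix.cons_val_one, Matrix.cons_val,
      Rat.smul_def, mul_one] at hg
    -- hg : ↑(g 0) + ↑(g 1) * lam + ↑(g 2) * ρ = 0
    by_cases h1 : g 1 = 0
    · exfalso
      rw [h1, Rat.cast_zero, zero_mul, add_zero] at hg
      by_cases h2 : g 2 = 0
      · rw [h2, Rat.cast_zero, zero_mul, add_zero] at hg
        have h0 : g 0 = 0 := by exact_mod_cast hg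
        fin_cases i
        · exact hi h0
        · exact hi h1
        · exact hi h2
      · have hne : ((g 2 : ℚ) : ℝ) ≠ 0 := by exact_mod_cast h2
        apply hρ
        refine ⟨-(g 0) / g 2, ?_⟩
        push_cast
        field_simp
        linarith
    · have hne : ((g 1 : ℚ) : ℝ) ≠ 0 := by exact_mod_cast h1
      have hlam : lam = ((-(g 0) / g 1 : ℚ) : ℝ) + ((-(g 2) / g 1 : ℚ) : ℝ) * ρ := by
        push_cast
        field_simp
        linarith
      by_cases h2 : g 2 = 0
      · right
        refine ⟨-(g 0) / g 1, ?_⟩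
        rw [hlam, h2]
        push_cast
        ring
      · left
        refine ⟨-(g 0) / g 1, -(g 2) / g 1, ?_, hlam⟩
        exact div_ne_zero (neg_ne_zero.mpr h2) h1

/-- `1, ρ, ρ²` `ℚ`-free forces `ρ` irrational (for `ρ = r ∈ ℚ`, `r·1 − 1·ρ + 0·ρ² = 0`). -/
theorem irrational_of_linearIndependent_one_rho_sq {ρ : ℝ} (h3 : LinearIndependent ℚ ![(1 : ℝ), ρ, ρ ^ 2]) :
    Irrational ρ := by
  rintro ⟨r, hr⟩
  have hli := Fintype.linearIndependent_iff.mp h3 (![r, -1, 0]) (by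
    simp only [Fin.sum_univ_three, Matrix.cons_val_zero, Matrix.cons_val_one, Matrix.cons_val]
    simp only [Rat.smul_def]
    rw [← hr]
    push_cast
    ring)
  have := hli 1
  simp at this

/-- **THE LOG-LINE LEMMA of T″ (all slopes; RULING L1839 sub-case list, polynomial level).** Let `1, ρ, ρ²` be
`ℚ`-linearly independent, `lam ∈ ℝ` any slope, `c₀, c₁ ≠ 0`, and `g¹₀..g¹_{K₁}`, `g²₀..g²_{K₂} ∈ ℂ[X, Y]` (in T″:
`gⁱ_k = G_{ik}(ρ, ·, ·)`).  Along the log-line branch `X = e^{x}`, `Y = c₀ e^{lam·x}` (so `X^ρ = e^{ρx}`,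
`Y^ρ = c₁ e^{lam·ρ·x}`) assume BOTH curve identities near `x₀`:
`Σ_k g¹_k(X, Y) e^{kρx} = 0` and `Σ_k g²_k(X, Y) c₁^k e^{k·lam·ρ·x} = 0`.  Then the top coefficient of one of the
two curves vanishes AT THE BASE POINT: `g¹_{K₁}(X(x₀), Y(x₀)) = 0 ∨ g²_{K₂}(X(x₀), Y(x₀)) = 0` — i.e. `¬ GenuineAt`.
Proof: `slope_trichotomy` — `1, lam, ρ` free ⇒ all `g¹_k = 0` (`mvpoly_family_eq_zero_of_expSum`); `lam ∈ ℚ` ⇒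
the top slice of the first identity vanishes identically (`mvpoly_slice_eq_zero_of_expSum_rat`); `lam = α + βρ`,
`β ≠ 0` ⇒ all `g²_k = 0` (`mvpoly_family_eq_zero_of_expSum_quadratic`, using `1, ρ, ρ²` free). -/
theorem logLine_top_coeff_eq_zero {K₁ K₂ : ℕ} {ρ : ℝ} (h3 : LinearIndependent ℚ ![(1 : ℝ), ρ, ρ ^ 2])
    (lam : ℝ) {c₀ c₁ : ℂ} (hc₀ : c₀ ≠ 0) (hc₁ : c₁ ≠ 0)
    (g₁ : Fin (K₁ + 1) → MvPolynomial (Fin 2) ℂ) (g₂ : Fin (K₂ + 1) → MvPolynomial (Fin 2) ℂ) {x₀ : ℂ}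
    (h₁ : ∀ᶠ x in 𝓝 x₀, ∑ k : Fin (K₁ + 1),
      MvPolynomial.eval ![cexp x, c₀ * cexp ((lam : ℂ) * x)] (g₁ k) * cexp (((k : ℕ) : ℂ) * (ρ : ℂ) * x) = 0)
    (h₂ : ∀ᶠ x in 𝓝 x₀, ∑ k : Fin (K₂ + 1),
      MvPolynomial.eval ![cexp x, c₀ * cexp ((lam : ℂ) * x)] (g₂ k) *
        (c₁ ^ (k : ℕ) * cexp (((k : ℕ) : ℂ) * ((lam * ρ : ℝ) : ℂ) * x)) = 0) :
    MvPolynomial.eval ![cexp x₀, c₀ * cexp ((lam : ℂ) * x₀)] (g₁ (Fin.last K₁)) = 0 ∨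
      MvPolynomial.eval ![cexp x₀, c₀ * cexp ((lam : ℂ) * x₀)] (g₂ (Fin.last K₂)) = 0 := by
  have hρ : Irrational ρ := irrational_of_linearIndependent_one_rho_sq h3
  rcases slope_trichotomy hρ lam with hfree | ⟨α, β, hβ, hlam⟩ | ⟨r, hr⟩
  · left
    have hz := mvpoly_family_eq_zero_of_expSum hfree hc₀ g₁ h₁ (Fin.last K₁)
    rw [hz, map_zero]
  · right
    subst hlam
    have hz := mvpoly_family_eq_zero_of_expSum_quadratic h3 hβ hc₀ hc₁ g₂ (x₀ := x₀) h₂ (Fin.last K₂)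
    rw [hz, map_zero]
  · left
    subst hr
    exact mvpoly_slice_eq_zero_of_expSum_rat hρ r g₁ h₁ (Fin.last K₁) x₀

/-! ### Controls -/

/-- Non-vacuity: two distinct frequencies. If `a e^{x} + b e^{2x} = 0` near `0` then `a = b = 0`. -/
example (a b : ℂ) (h : ∀ᶠ x in 𝓝 (0 : ℂ), a * cexp (1 * x) + b * cexp (2 * x) = 0) : a = 0 ∧ b = 0 := by
  have hμ : Function.Injective (![1, 2] : Fin 2 → ℂ) := by
    intro i j hij
    fin_cases i <;> fin_cases j <;> simp_all
  have key := expPoly_coeff_eq_zero_of_eventually (μ := ![1, 2]) hμ (c := ![a, b]) (x₀ := 0) (by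
    filter_upwards [h] with x hx
    simpa [Fin.sum_univ_two] using hx)
  have ha := congr_fun key 0
  have hb := congr_fun key 1
  simp at ha hb
  exact ⟨ha, hb⟩

/-- Distinctness of the frequencies is NECESSARY: with `μ = (1, 1)` and `c = (1, −1)` the exponential polynomial
vanishes identically although `c ≠ 0`. -/
example : ∃ (μ c : Fin 2 → ℂ), ¬ Function.Injective μ ∧ c ≠ 0 ∧ ∀ x : ℂ, ∑ i, c i * cexp (μ i * x) = 0 := by
  refine ⟨![1, 1], ![1, -1], ?_, ?_, ?_⟩
  · intro hinj
    have := @hinj 0 1 (by simp)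
    exact absurd this (by decide)
  · intro h
    have := congr_fun h 0
    simp at this
  · intro x
    simp [Fin.sum_univ_two]

/-- Irrationality of `ρ` is NECESSARY in `poly_family_eq_zero_of_expSum`: for `ρ = 1`, `g₀ = X`, `g₁ = −1` one has
`g₀(e^y) + g₁(e^y) e^{y} = e^y − e^y = 0` identically although `g ≠ 0`. -/
example : ∃ g : Fin (1 + 1) → Polynomial ℂ, g ≠ 0 ∧
    ∀ y : ℂ, ∑ k : Fin (1 + 1), (g k).eval (cexp y) * cexp (((k : ℕ) : ℂ) * ((1 : ℝ) : ℂ) * y) = 0 := by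
  refine ⟨![Polynomial.X, -1], ?_, ?_⟩
  · intro h
    have := congr_fun h 0
    simp at this
  · intro y
    simp [Fin.sum_univ_succ]

end Epart

end Summit.Schanuel.Schanuel.Theorems.RootDecomp1BMovingZero

end
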